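import Literature.MathematicalPhysics.QuantumFieldTheory.Balaban1983to89.B9B8KnitLetterXDiffCinvReg335

/-!
# `Balaban1983to89.B9B8KnitBondCLettersAtParsReg335` — T. Bałaban, *Propagators for lattice gauge theories in a background field*, Commun. Math. Phys. **99**
# (1985) 389–434 [Balaban1985BackgroundPropagators], (3.25) p. 395, Thm 3.2 (3.48) p. 398: THE `(Q′G′²Q′*)⁻¹`-SECTOR OF THE BOND JUNCTION AT `(parSymY, parKnitY)`
# FOR EVERY MEMBER OF THE LOCAL CLASS (3.35) p. 396 — t2s-1's 5a §3 ∕ §5 (`B9B8KnitBondCLettersAtPars`) WITHOUT [5]'s global (52), the knit-side letters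
# from files 1–4 of this chain (the level-weighted `E`)

statement-level skeleton of published theorems with citation tags; proofs where landed; nothing here is a claim about the Yang–Mills mass gap

THE PRINT (page owner r06).  (3.25)–(3.26) pp. 394–395, (3.27) p. 395, (3.49) p. 399 (the `DPD*` entry), (3.19) p. 393 vs (3.40) p. 397 (print has ONE transporter
convention; the junction `parSymY ↔ parKnitY` is a formalisation artefact), Thm 3.1 (3.42) p. 397, Thm 3.2 (3.48) p. 398, (3.35) p. 396, (3.90) pp. 409–410, (3.95)
p. 411, (3.106) p. 414; [4] Prop. 2.2 (2.50)–(2.55) p. 232, Lemma 2.1 (2.60)–(2.61) p. 234, (2.66)–(2.67) p. 234; [5] (17)–(20) pp. 20–21, (44) p. 24, (52)–(53) pp. 26–27.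

WHY THIS FILE (cell `pub-ymgap`, node N06, seat `dag-n06-j` gen 36; file 5 of the chain «Thm 3.3's block at `parKnitY` on (3.35)»).  `Δ_a(U; parKnitY) − Δ_a(U; parSymY) =
D_U(R_K − R_S)D*_U = −(D_UP_KD*_U − D_UP_SD*_U)` ((3.26); `B9B8KnitBondResolvent.deltaAY_sub_deltaAY_eq_DPDsY_sub`).  p38's 2b `hasMajorant_conj_DPDsY_sub` prices the
difference of the two `DPD*` words from thirteen member-level letter majorants; t2s-1's 2c discharged them at `(parSymY, parKnitY)` under the GLOBAL (52).  THIS FILE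
is 2c ON (3.35): the `G′`-sector and the `Q′`-sector from file 3 (`B9B8KnitBondGpQLettersAtParsReg335`), the `C`-sector from file 4 (`B9B8KnitLetterXDiffCinvReg335`) through
5a §3 ∕ §5 re-run here (§1), all on n06-l's two local lemmas and the level-weighted `E`; the binder list is t2s-1's with THREE honest changes: the (52) data
`(hGa, hU, hα, h52)` become `U ∈ (bg9KP … G i).Reg335 c₀ α₀` + `K_pl(Mα₀)L⁴ < α₀′` (+ `|u| ≤ 1` on `G`, a section `ιB` of `β`), the scale-transfer constant carries
`1 ≤ C`, and the entry differences take the transfer of `ℓ⁻¹` (instead of `ℓ`, `ℓ²`) at `(δ_b, α_b, Λ)`, `Λ ≥ 1`.  The conclusion and its constant `κ_J` are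
t2s-1's VERBATIM.

WHAT IS PROVED (sorry-free; 0 `def`).  ★★ `hasMajorant_conj_XinvY_parKnitY_of_data_reg335` ((3.48) at the knit letter from def-Y's-side data, on (3.35)),
★★★ `cLetters_pars_of_data_reg335` (the three `C`-inputs of 2b's `hasMajorant_conj_DPDsY_sub` at one rate `ρ` and one constant `max K K_K`, on (3.35)) — 5a §3 ∕ §5
conclusions VERBATIM; the sequel `B9B8KnitBondWordDiffAtParsReg335` assembles 2b.
HONEST SCOPE.  Bookkeeping over landed results (2b, 5a §4, files 1–4); the `parSymY`-side data (M5.5's `A, A₁, A₂`, M5.6's `K`), the geometry facts and the windows are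
HYPOTHESES; helper, count-neutral; N06 NOT discharged; nothing continuum ∕ OS ∕ mass gap ∕ Clay — the Yang–Mills mass gap is NOT proved here.  No `sorry`, no `axiom`,
no `instance`, no `notation`, no `def`.  NEW file.
RELATED, NOT DUPLICATED (searched 2026-08-30: `rg -l -w "WordDiffAtParsReg335|cLetters_pars_of_data_reg335|DPDsY_sub_pars_reg335"` over `lean/Literature` = ∅): t2s-1's
`B9B8KnitBondWordDiffAtPars` ∕ `B9B8KnitBondCLettersAtPars` (the (52) originals; `kGeo_eta_pow_four`, `hasMajorant_conj_XinvY_sub_pars_of_majorants`,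
`hasMajorantHom_rightEntry_parSymY`, the `parSymY`-side `Q′`-letters USED BY NAME), p38's 2b `B9B8KnitBondWordDiff` (the engine, USED BY NAME).
-/

noncomputable section

namespace Literature.MathematicalPhysics.QuantumFieldTheory.Balaban1983to89.B9B8KnitBondCLettersAtParsReg335

open Node00 B9Thm311DeltaPrimePos B9Thm311ReadingCoords
open B6Geom246MultiLevelBox (blkOf)
open B6KLevelCensusIndexV1 (KIdx kGeo)
open B6GlobalChartV1 (blkV1)
open B6Ineq2142KLevelV1 (β)
open B6RandomWalk (HasMajorant Triangle254 Ineq261 Ineq263 hasMajorant_mono c1_nonneg)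
open B6RandomWalkHom (HasMajorantHom hasMajorantHom_mono)
open B9Thm34Ext (toB6)
open B9GeoNormsKLevelV1 (geo9K geo9K_dist_nonneg)
open B9GeoLemma21KLevelV1 (geo9K_len_pos)
open B9Ineq347 (ScaleTransfer)
open B9Ineq349Hom (hasMajorantHom_rate_mono)
open B9Eq352DivFormLetters (conj)
open B9Eq352GradLetters (diffLetter)
open B9Eq376POneLetters (conjHom gradLin divLin)
open B9Eq3104CutoffCommutators (DPDsY)
open B9Ineq349SiteComposite (etaS_pos)
open B9Cor36GpCoverBindersUnitary (etaS_eq_kGeo_eta_of_cf)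
open B9B8KnitBondGpLettersAtPars (hasMajorantHom_rightEntry_parSymY)
open B9B8KnitBondCLettersAtPars (hasMajorantHom_conjHom_QpY_parSymY hasMajorantHom_conjHom_QpsY_parSymY hasMajorant_conj_XinvY_sub_pars_of_majorants)
open B9B8KnitLetterXDiffMajorant (rate_le hasMajorant_rate_mono)
open B9B8KnitLetterTransferReg335 (hasMajorant_conj_smul_sub_print_reg335 hasMajorant_conj_GpY_parKnitY_of_parSymY_reg335)
open B9B8KnitBondGpQLettersAtParsReg335 (hasMajorantHom_conjHom_QpY_parKnitY_reg335 hasMajorantHom_conjHom_QpsY_parKnitY_reg335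
  hasMajorantHom_conjHom_QpY_sub_pars_reg335 hasMajorantHom_conjHom_QpsY_sub_pars_reg335 hasMajorantHom_leftEntry_parKnitY_reg335
  hasMajorantHom_leftEntry_sym_sub_knit_reg335 hasMajorantHom_rightEntry_sym_sub_knit_reg335)
open B9B8KnitLetterXDiffCinvReg335 (hasMajorant_conj_XY_sym_sub_knit_reg335 hasMajorant_conj_XinvY_parKnitY_of_letters_reg335)
open B7Prop2Explicit (C0 c2' unitaryUnits)
open B9B8AveragingJunction (parKnitY)
open B9Eq3124HZKnitPairReg335Y (parKnitY_mem_unitary_of_reg335P)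
open B9BackgroundsKLevelV1P (bg9KP mem_of_reg335P)
open B9C2FormBoxRegimeY (Kpl)
open scoped Matrix Matrix.Norms.L2Operator

variable {d ℓ : ℕ} {hd : 1 ≤ d + 1} {hL : Odd (ℓ + 1) ∧ 1 < ℓ + 1} {b₀ b₁ : ℝ}
variable (i : KIdx d ℓ hd hL b₀ b₁) {N : ℕ} {G : Subgroup (Matrix (Fin N) (Fin N) ℂ)ˣ}
variable {ι : Type} [Fintype ι] [DecidableEq ι] (b : Module.Basis ι ℝ (Matrix (Fin N) (Fin N) ℂ))
variable [Fintype (geo9K i).Site] [DecidableEq (geo9K i).Site] {Rr : ℝ} {Hp : Prop} (ιB : BlkY i → IBondY i)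

/-! ## The `C`-sector (t2s-1's 5a §3 ∕ §5) on (3.35) -/


/-- ★★ **[B9] THM 3.2 (3.48) AT PRINT's KNIT LETTER FROM def-Y's-SIDE DATA, FOR EVERY MEMBER OF THE LOCAL CLASS (3.35)** (t2s-1's 5a §3 with (52) replaced by
`U ∈ (bg9KP … G i).Reg335 c₀ α₀` + the knit numerics, one new binder `1 ≤ C`; SAME conclusion).  `G ≤ U(N)`,
print's units `c_f = L^k`, a real basis with coordinate bound `M₂`; DISPLAYED at the rate `δ₀`: M5.5's (3.42)₁ majorant `A·ℓ²·e^{−δ₀d}` of `conj b(η²G′(U; parSymY))`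
and M5.6's (3.48) majorant `K·(ℓ⁴)⁻¹·e^{−δ₀d}` of `conj b(η⁻⁴X(U; parSymY)⁻¹)`; file 9's window `θ_EAc₁(d_g,δ₀,α_g) < 1` (`θ_E = 32(d+1)²α₀′M₂Σ‖b_j‖`) with
(2.61)∕(2.63) at `(δ₀, α_g)`; a base rate `δ ≤ (1−α_g)δ₀` carrying 23c's ladder `δ₁ = (1−α′)(1−α_st)δ`, `δ₂ = (1−α′)(1−α_st)δ₁`, `δ₃ = (1−α′)(1−α_st)δ₂` (scale
transfers of `ℓ²` at `δ`, `δ₁` (constant `C`) and of `ℓ⁻⁴` at `δ₂` (constant `C₄`), (2.61) at `((1−α_st)δ, α′)`, `((1−α_st)δ₁, α′)`, `((1−α_st)δ₂, α′)`, (2.61)∕(2.63)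
at `(δ₃, α)`) and 23c's window `θ_FKC₄c₁((1−α_st)δ₂,α′)c₁(δ₃,α) < 1`, `θ_F` = 23b's constant at `(A, A_K, θ_E)`, `A_K = Ac₁(d_g,δ₀,α_g)(1 − θ_EAc₁(d_g,δ₀,α_g))⁻¹`
(file 9's knit-side (3.42)₁ constant).  THEN `conj b(η⁻⁴X(U; parKnitY)⁻¹) ≺ Kc₁(d₄,δ₃,α)(1 − θ_FKC₄c₁c₁(d₄,δ₃,α))⁻¹·(ℓ(a)⁴)⁻¹·e^{−(1−α)δ₃d(a,a′)}` on `(s, j) ↦ ιB s`.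
[cite: Balaban1985BackgroundPropagators, Thm 3.2 (3.48) p.398, Thm 3.1 (3.42) p.397, (3.19) p.393, (3.25) p.395, (3.90) pp.409–410, (3.95) p.411; Balaban1984PropagatorsII, (2.50)–(2.52) p.232, (2.60)–(2.61) p.234, (2.66)–(2.67) p.234; Balaban1985Averaging, (52)–(53) pp.26–27] -/
theorem hasMajorant_conj_XinvY_parKnitY_of_data_reg335 [Nonempty (Fin N)]
    (hG1 : ∀ u : (Matrix (Fin N) (Fin N) ℂ)ˣ, u ∈ G → ‖(u : Matrix (Fin N) (Fin N) ℂ)‖ ≤ 1) (hGU : G ≤ unitaryUnits (Matrix (Fin N) (Fin N) ℂ))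
    {U : CfgY (Matrix (Fin N) (Fin N) ℂ) i} {c₀ α₀ : ℝ} (hc : c₀ ≤ 10) (hMα : 0 ≤ (kGeo i).M * α₀)
    (hreg : (bg9KP (Matrix (Fin N) (Fin N) ℂ) G i).Reg335 c₀ α₀ U) {α₀' : ℝ} (hα' : 0 < α₀') (hα3 : C0 (d + 1) * α₀' ≤ 1 / 3)
    (hα2 : 2 * α₀' ≤ c2' (d + 1) (ℓ + 1)) (hK : Kpl i ((kGeo i).M * α₀) * (kGeo i).L ^ 4 < α₀')
    (hι : ∀ s, β i.hN i.D i.hk (ιB s) = s)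
    (hcf : i.cf = (((ℓ + 1 : ℕ) : ℝ)) ^ i.k)
    {M₂ : ℝ} (hM₂ : 0 ≤ M₂) (hrepr : ∀ (v : Matrix (Fin N) (Fin N) ℂ) (j : ι), |b.repr v j| ≤ M₂ * ‖v‖)
    -- def-Y's-side data and file 9's window
    (dg : ℕ) {δ₀ αg A K : ℝ} (hA : 0 ≤ A) (hK0 : 0 ≤ K) (hαδg : 0 ≤ (1 - αg) * δ₀) (hαδg' : 0 ≤ αg * δ₀)
    (htri : Triangle254 (toB6 (geo9K i) Rr Hp)) (hrefl : ∀ y : (geo9K i).Site, (geo9K i).dist y y = 0)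
    (h261g : Ineq261 dg (toB6 (geo9K i) Rr Hp) δ₀ αg) (h263g : Ineq263 dg (toB6 (geo9K i) Rr Hp) δ₀ αg)
    {θE AK : ℝ} (hθE : θE = 32 * ((d : ℝ) + 1) ^ 2 * α₀' * (M₂ * ∑ j, ‖b j‖))
    (hAK : AK = A * B6.c1 dg δ₀ αg * (1 - θE * A * B6.c1 dg δ₀ αg)⁻¹) (hsmallg : θE * A * B6.c1 dg δ₀ αg < 1)
    (hGs : HasMajorant (g := toB6 (geo9K i) Rr Hp) (fun p : SiteY i × ι => ιB (blkOf i.D.toDomains p.1))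
      (conj b ((etaS i ^ 2) • (GpY i (parSymY i) U).restrictScalars ℝ)) (fun a a' => A * (geo9K i).len a ^ 2 * Real.exp (-(δ₀ * (geo9K i).dist a a'))))
    (hT₀ : HasMajorant (g := toB6 (geo9K i) Rr Hp) (fun q : BlkY i × ι => ιB q.1)
      (conj b ((etaS i ^ 2 * etaS i ^ 2)⁻¹ • (XinvY i (parSymY i) (GpY i (parSymY i)) U).restrictScalars ℝ))
      (fun a a' => K * ((geo9K i).len a ^ 4)⁻¹ * Real.exp (-(δ₀ * (geo9K i).dist a a'))))
    -- 23c's ladder on a base rate `δ ≤ (1−α_g)δ₀`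
    (d₁ d₂ d₃ d₄ : ℕ) {δ δ₁ δ₂ δ₃ αst α' α C C₄ : ℝ} (hδ : δ ≤ (1 - αg) * δ₀)
    (hδ₁ : δ₁ = (1 - α') * ((1 - αst) * δ)) (hδ₂ : δ₂ = (1 - α') * ((1 - αst) * δ₁)) (hδ₃ : δ₃ = (1 - α') * ((1 - αst) * δ₂))
    (hC : 0 ≤ C) (hC1 : 1 ≤ C) (hC₄ : 0 ≤ C₄) (hαδ : 0 ≤ αst * δ) (hα'0 : 0 ≤ α') (hα'1 : α' ≤ 1) (hδ' : 0 ≤ (1 - αst) * δ)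
    (hαδ₂ : 0 ≤ αst * δ₁) (hδ'₂ : 0 ≤ (1 - αst) * δ₁) (hαδ₃ : 0 ≤ αst * δ₂) (hδ'₃ : 0 ≤ (1 - αst) * δ₂) (hαδ₄ : 0 ≤ (1 - α) * δ₃)
    (hST : ScaleTransfer (geo9K i) δ αst C (fun a => (geo9K i).len a ^ 2))
    (h261 : Ineq261 d₁ (toB6 (geo9K i) Rr Hp) ((1 - αst) * δ) α')
    (hST₂ : ScaleTransfer (geo9K i) δ₁ αst C (fun a => (geo9K i).len a ^ 2))
    (h261₂ : Ineq261 d₂ (toB6 (geo9K i) Rr Hp) ((1 - αst) * δ₁) α')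
    (hST₃ : ScaleTransfer (geo9K i) δ₂ αst C₄ (fun a => ((geo9K i).len a ^ 4)⁻¹))
    (h261₃ : Ineq261 d₃ (toB6 (geo9K i) Rr Hp) ((1 - αst) * δ₂) α')
    (h261₄ : Ineq261 d₄ (toB6 (geo9K i) Rr Hp) δ₃ α) (h263₄ : Ineq263 d₄ (toB6 (geo9K i) Rr Hp) δ₃ α)
    {θF : ℝ} (hθF : θF = (2 * (8 * ((d : ℝ) + 1) ^ 2 * α₀') * (M₂ * ∑ j, ‖b j‖)) * (M₂ * ∑ j, ‖b j‖) * (A * A * C * B6.c1 d₁ ((1 - αst) * δ) α') +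
          (M₂ * ∑ j, ‖b j‖) * (M₂ * ∑ j, ‖b j‖) * ((A + AK) * (AK * (θE * A) * C * B6.c1 d₁ ((1 - αst) * δ) α') * C * B6.c1 d₂ ((1 - αst) * δ₁) α') +
          (M₂ * ∑ j, ‖b j‖) * ((2 * (8 * ((d : ℝ) + 1) ^ 2 * α₀') * (M₂ * ∑ j, ‖b j‖))) * (AK * AK * C * B6.c1 d₁ ((1 - αst) * δ) α'))
    (hsmall : θF * K * C₄ * B6.c1 d₃ ((1 - αst) * δ₂) α' * B6.c1 d₄ δ₃ α < 1) :
    HasMajorant (g := toB6 (geo9K i) Rr Hp) (fun q : BlkY i × ι => ιB q.1)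
      (conj b ((etaS i ^ 2 * etaS i ^ 2)⁻¹ • (XinvY i (parKnitY i) (GpY i (parKnitY i)) U).restrictScalars ℝ))
      (fun a a' => K * B6.c1 d₄ δ₃ α * (1 - θF * K * C₄ * B6.c1 d₃ ((1 - αst) * δ₂) α' * B6.c1 d₄ δ₃ α)⁻¹ * ((geo9K i).len a ^ 4)⁻¹ *
        Real.exp (-((1 - α) * δ₃ * (geo9K i).dist a a'))) := by
  subst hθF hδ₃ hδ₂ hδ₁ hAK hθE
  have hdnn : ∀ y y' : (geo9K i).Site, 0 ≤ (geo9K i).dist y y' := geo9K_dist_nonneg i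
  have hSb : 0 ≤ ∑ j, ‖b j‖ := Finset.sum_nonneg fun _ _ => norm_nonneg _
  have hθE0 : 0 ≤ 32 * ((d : ℝ) + 1) ^ 2 * α₀' * (M₂ * ∑ j, ‖b j‖) := mul_nonneg (by positivity) (mul_nonneg hM₂ hSb)
  have hcg : 0 ≤ B6.c1 dg δ₀ αg := c1_nonneg dg δ₀ αg
  have hAK0 : 0 ≤ A * B6.c1 dg δ₀ αg * (1 - 32 * ((d : ℝ) + 1) ^ 2 * α₀' * (M₂ * ∑ j, ‖b j‖) * A * B6.c1 dg δ₀ αg)⁻¹ :=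
    mul_nonneg (mul_nonneg hA hcg) (inv_nonneg.2 (sub_nonneg.2 hsmallg.le))
  -- `δ ≤ (1−α_g)δ₀ ≤ δ₀`
  have hδδ₀ : δ ≤ δ₀ := hδ.trans (by linarith only [hαδg'])
  -- the block-diagonal letter and the knit-side (3.42)₁ majorant from def-Y's side (file 9)
  have hE := hasMajorant_conj_smul_sub_print_reg335 i b ιB (Rr := Rr) (Hp := Hp) hG1 hGU hc hMα hreg hα' hα3 hα2 hK hι hcf hM₂ hrepr
  have hGk := hasMajorant_conj_GpY_parKnitY_of_parSymY_reg335 i b ιB (Rr := Rr) (Hp := Hp) hG1 hGU hc hMα hreg hα' hα3 hα2 hK hι hcf hM₂ hrepr dg hA hαδg htri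
    hrefl hdnn h261g h263g hsmallg hGs
  -- the three data at the base rate `δ`
  have hGs' := hasMajorant_rate_mono i (Rr := Rr) (Hp := Hp) (fun p : SiteY i × ι => ιB (blkOf i.D.toDomains p.1))
    (fun a => (geo9K i).len a ^ 2) hA (fun a => sq_nonneg _) hδδ₀ hGs
  have hGk' := hasMajorant_rate_mono i (Rr := Rr) (Hp := Hp) (fun p : SiteY i × ι => ιB (blkOf i.D.toDomains p.1))
    (fun a => (geo9K i).len a ^ 2) hAK0 (fun a => sq_nonneg _) hδ hGk
  have hT₀' := hasMajorant_rate_mono i (Rr := Rr) (Hp := Hp) (fun q : BlkY i × ι => ιB q.1) (fun a => ((geo9K i).len a ^ 4)⁻¹) hK0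
    (fun a => inv_nonneg.2 (pow_nonneg (geo9K_len_pos i a).le 4)) hδδ₀ hT₀
  exact hasMajorant_conj_XinvY_parKnitY_of_letters_reg335 i b ιB hG1 hGU hc hMα hreg hα' hα3 hα2 hK hM₂ hrepr d₁ d₂ d₃ d₄ hA hAK0 hθE0 hK0 hC hC1 hC₄ hαδ hα'0 hα'1
    hδ' hαδ₂ hδ'₂ hαδ₃ hδ'₃ hαδ₄ htri hrefl hdnn hST h261 hST₂ h261₂ hST₃ h261₃ h261₄ h263₄ hsmall hE hGs' hGk' hT₀'




/-- ★★★ **THE `(Q′G′²Q′*)⁻¹`-SECTOR OF THE JUNCTION AT `(parSymY, parKnitY)` FOR EVERY MEMBER OF THE LOCAL CLASS (3.35)** (t2s-1's 5a §5; SAME conclusions).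
Under the hypotheses of `hasMajorant_conj_XinvY_parKnitY_of_data_reg335` (class (3.35) + knit numerics,
`c_f = L^k`, basis data, def-Y's-side data `hGs` ∕ `hT₀` at the rate `δ₀`, file 9's window, 23c's ladder `δ ≥ δ₁ ≥ δ₂ ≥ δ₃` with its window), `0 ≤ α`, and ONE more
Lemma 2.1 for the difference ((2.61) at `(δ₅, β₅)`, the transfer of `ℓ⁻⁴` at `(δ₅, α₅, Λ₄)`, `Λ₄ ≥ 1`, `ρ + 2(α₅+β₅)δ₅ ≤ (1−α)δ₃`): with `B₁ = max K K_K`,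
`K_K = Kc₁(d₄,δ₃,α)(1 − θ_FKC₄c₁((1−α_st)δ₂,α′)c₁(d₄,δ₃,α))⁻¹`, all three `C`-inputs of 2b's `hasMajorant_conj_DPDsY_sub` hold AT THE RATE `ρ`:
`conj b(η⁻⁴X_S⁻¹) ≺ B₁(ℓ⁴)⁻¹e^{−ρd}`, `conj b(η⁻⁴X_K⁻¹) ≺ B₁(ℓ⁴)⁻¹e^{−ρd}`, `conj b(η⁻⁴X_S⁻¹) − conj b(η⁻⁴X_K⁻¹) ≺ (B₁²θ_FΛ₄c₁(d₅,δ₅,β₅)²)(ℓ⁴)⁻¹e^{−ρd}` — `θ_F = O(α₀′)`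
(each of its three summands carries `α₀′` through `2·8(d+1)²α₀′` or `θ_E`).
[cite: Balaban1985BackgroundPropagators, Thm 3.2 (3.48) p.398, (3.25) p.395, (3.19) p.393, (3.90) pp.409–410, (3.95) p.411; Balaban1984PropagatorsII, Prop. 2.2 (2.50)–(2.52) p.232, Lemma 2.1 (2.60)–(2.61) p.234, (2.66)–(2.67) p.234; Balaban1985Averaging, (52)–(53) pp.26–27] -/
theorem cLetters_pars_of_data_reg335 [Nonempty (Fin N)]
    (hG1 : ∀ u : (Matrix (Fin N) (Fin N) ℂ)ˣ, u ∈ G → ‖(u : Matrix (Fin N) (Fin N) ℂ)‖ ≤ 1) (hGU : G ≤ unitaryUnits (Matrix (Fin N) (Fin N) ℂ))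
    {U : CfgY (Matrix (Fin N) (Fin N) ℂ) i} {c₀ α₀ : ℝ} (hc : c₀ ≤ 10) (hMα : 0 ≤ (kGeo i).M * α₀)
    (hreg : (bg9KP (Matrix (Fin N) (Fin N) ℂ) G i).Reg335 c₀ α₀ U) {α₀' : ℝ} (hα' : 0 < α₀') (hα3 : C0 (d + 1) * α₀' ≤ 1 / 3)
    (hα2 : 2 * α₀' ≤ c2' (d + 1) (ℓ + 1)) (hK : Kpl i ((kGeo i).M * α₀) * (kGeo i).L ^ 4 < α₀')
    (hι : ∀ s, β i.hN i.D i.hk (ιB s) = s)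
    (hcf : i.cf = (((ℓ + 1 : ℕ) : ℝ)) ^ i.k)
    {M₂ : ℝ} (hM₂ : 0 ≤ M₂) (hrepr : ∀ (v : Matrix (Fin N) (Fin N) ℂ) (j : ι), |b.repr v j| ≤ M₂ * ‖v‖)
    -- def-Y's-side data and file 9's window
    (dg : ℕ) {δ₀ αg A K : ℝ} (hA : 0 ≤ A) (hK0 : 0 ≤ K) (hαδg : 0 ≤ (1 - αg) * δ₀) (hαδg' : 0 ≤ αg * δ₀)
    (htri : Triangle254 (toB6 (geo9K i) Rr Hp)) (hrefl : ∀ y : (geo9K i).Site, (geo9K i).dist y y = 0)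
    (h261g : Ineq261 dg (toB6 (geo9K i) Rr Hp) δ₀ αg) (h263g : Ineq263 dg (toB6 (geo9K i) Rr Hp) δ₀ αg)
    {θE AK : ℝ} (hθE : θE = 32 * ((d : ℝ) + 1) ^ 2 * α₀' * (M₂ * ∑ j, ‖b j‖))
    (hAK : AK = A * B6.c1 dg δ₀ αg * (1 - θE * A * B6.c1 dg δ₀ αg)⁻¹) (hsmallg : θE * A * B6.c1 dg δ₀ αg < 1)
    (hGs : HasMajorant (g := toB6 (geo9K i) Rr Hp) (fun p : SiteY i × ι => ιB (blkOf i.D.toDomains p.1))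
      (conj b ((etaS i ^ 2) • (GpY i (parSymY i) U).restrictScalars ℝ)) (fun a a' => A * (geo9K i).len a ^ 2 * Real.exp (-(δ₀ * (geo9K i).dist a a'))))
    (hT₀ : HasMajorant (g := toB6 (geo9K i) Rr Hp) (fun q : BlkY i × ι => ιB q.1)
      (conj b ((etaS i ^ 2 * etaS i ^ 2)⁻¹ • (XinvY i (parSymY i) (GpY i (parSymY i)) U).restrictScalars ℝ))
      (fun a a' => K * ((geo9K i).len a ^ 4)⁻¹ * Real.exp (-(δ₀ * (geo9K i).dist a a'))))
    -- 23c's ladder on a base rate `δ ≤ (1−α_g)δ₀`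
    (d₁ d₂ d₃ d₄ : ℕ) {δ δ₁ δ₂ δ₃ αst α' α C C₄ : ℝ} (hδ : δ ≤ (1 - αg) * δ₀)
    (hδ₁ : δ₁ = (1 - α') * ((1 - αst) * δ)) (hδ₂ : δ₂ = (1 - α') * ((1 - αst) * δ₁)) (hδ₃ : δ₃ = (1 - α') * ((1 - αst) * δ₂))
    (hC : 0 ≤ C) (hC1 : 1 ≤ C) (hC₄ : 0 ≤ C₄) (hαδ : 0 ≤ αst * δ) (hα'0 : 0 ≤ α') (hα'1 : α' ≤ 1) (hδ' : 0 ≤ (1 - αst) * δ)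
    (hαδ₂ : 0 ≤ αst * δ₁) (hδ'₂ : 0 ≤ (1 - αst) * δ₁) (hαδ₃ : 0 ≤ αst * δ₂) (hδ'₃ : 0 ≤ (1 - αst) * δ₂) (hα0 : 0 ≤ α) (hαδ₄ : 0 ≤ (1 - α) * δ₃)
    (hST : ScaleTransfer (geo9K i) δ αst C (fun a => (geo9K i).len a ^ 2))
    (h261 : Ineq261 d₁ (toB6 (geo9K i) Rr Hp) ((1 - αst) * δ) α')
    (hST₂ : ScaleTransfer (geo9K i) δ₁ αst C (fun a => (geo9K i).len a ^ 2))
    (h261₂ : Ineq261 d₂ (toB6 (geo9K i) Rr Hp) ((1 - αst) * δ₁) α')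
    (hST₃ : ScaleTransfer (geo9K i) δ₂ αst C₄ (fun a => ((geo9K i).len a ^ 4)⁻¹))
    (h261₃ : Ineq261 d₃ (toB6 (geo9K i) Rr Hp) ((1 - αst) * δ₂) α')
    (h261₄ : Ineq261 d₄ (toB6 (geo9K i) Rr Hp) δ₃ α) (h263₄ : Ineq263 d₄ (toB6 (geo9K i) Rr Hp) δ₃ α)
    {θF : ℝ} (hθF : θF = (2 * (8 * ((d : ℝ) + 1) ^ 2 * α₀') * (M₂ * ∑ j, ‖b j‖)) * (M₂ * ∑ j, ‖b j‖) * (A * A * C * B6.c1 d₁ ((1 - αst) * δ) α') +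
          (M₂ * ∑ j, ‖b j‖) * (M₂ * ∑ j, ‖b j‖) * ((A + AK) * (AK * (θE * A) * C * B6.c1 d₁ ((1 - αst) * δ) α') * C * B6.c1 d₂ ((1 - αst) * δ₁) α') +
          (M₂ * ∑ j, ‖b j‖) * ((2 * (8 * ((d : ℝ) + 1) ^ 2 * α₀') * (M₂ * ∑ j, ‖b j‖))) * (AK * AK * C * B6.c1 d₁ ((1 - αst) * δ) α'))
    (hsmall : θF * K * C₄ * B6.c1 d₃ ((1 - αst) * δ₂) α' * B6.c1 d₄ δ₃ α < 1)
    {KK : ℝ} (hKK : KK = K * B6.c1 d₄ δ₃ α * (1 - θF * K * C₄ * B6.c1 d₃ ((1 - αst) * δ₂) α' * B6.c1 d₄ δ₃ α)⁻¹)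
    -- the difference's Lemma 2.1
    (d₅ : ℕ) {δ₅ α₅ β₅ ρ Λ₄ : ℝ} (hΛ₄ : 1 ≤ Λ₄) (hρ : 0 ≤ ρ) (hα₅ : 0 ≤ α₅) (hβ₅ : 0 ≤ β₅) (hδ₅ : 0 ≤ δ₅)
    (hr₅ : ρ + 2 * (α₅ + β₅) * δ₅ ≤ (1 - α) * δ₃) (h261₅ : Ineq261 d₅ (toB6 (geo9K i) Rr Hp) δ₅ β₅)
    (hT4₅ : ScaleTransfer (geo9K i) δ₅ α₅ Λ₄ (fun a => ((geo9K i).len a ^ 4)⁻¹)) :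
    HasMajorant (g := toB6 (geo9K i) Rr Hp) (fun q : BlkY i × ι => ιB q.1)
        (conj b ((etaS i ^ 2 * etaS i ^ 2)⁻¹ • (XinvY i (parSymY i) (GpY i (parSymY i)) U).restrictScalars ℝ))
        (fun a a' => max K KK * ((geo9K i).len a ^ 4)⁻¹ * Real.exp (-(ρ * (geo9K i).dist a a'))) ∧
      HasMajorant (g := toB6 (geo9K i) Rr Hp) (fun q : BlkY i × ι => ιB q.1)
        (conj b ((etaS i ^ 2 * etaS i ^ 2)⁻¹ • (XinvY i (parKnitY i) (GpY i (parKnitY i)) U).restrictScalars ℝ))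
        (fun a a' => max K KK * ((geo9K i).len a ^ 4)⁻¹ * Real.exp (-(ρ * (geo9K i).dist a a'))) ∧
      HasMajorant (g := toB6 (geo9K i) Rr Hp) (fun q : BlkY i × ι => ιB q.1)
        (conj b ((etaS i ^ 2 * etaS i ^ 2)⁻¹ • (XinvY i (parSymY i) (GpY i (parSymY i)) U).restrictScalars ℝ) -
          conj b ((etaS i ^ 2 * etaS i ^ 2)⁻¹ • (XinvY i (parKnitY i) (GpY i (parKnitY i)) U).restrictScalars ℝ))
        (fun a a' => (max K KK * max K KK * θF * Λ₄ * B6.c1 d₅ δ₅ β₅ ^ 2) * ((geo9K i).len a ^ 4)⁻¹ * Real.exp (-(ρ * (geo9K i).dist a a'))) := by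
  -- §3 at the knit letter (rate `(1−α)δ₃`, constant `K_K`)
  have hCK := hasMajorant_conj_XinvY_parKnitY_of_data_reg335 i b ιB (Rr := Rr) (Hp := Hp) hG1 hGU hc hMα hreg hα' hα3 hα2 hK hι hcf hM₂ hrepr dg hA hK0 hαδg hαδg'
    htri hrefl h261g h263g hθE hAK hsmallg hGs hT₀ d₁ d₂ d₃ d₄ hδ hδ₁ hδ₂ hδ₃ hC hC1 hC₄ hαδ hα'0 hα'1 hδ' hαδ₂ hδ'₂ hαδ₃ hδ'₃ hαδ₄ hST h261 hST₂ h261₂ hST₃ h261₃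
    h261₄ h263₄ hθF hsmall
  subst hKK hθF hδ₃ hδ₂ hδ₁ hAK hθE
  have hdnn : ∀ y y' : (geo9K i).Site, 0 ≤ (geo9K i).dist y y' := geo9K_dist_nonneg i
  have hU : ∀ μ x, U μ x ∈ G := fun μ x => mem_of_reg335P (G := G) i hreg μ x
  have hUu : ∀ μ x, U μ x ∈ unitaryUnits (Matrix (Fin N) (Fin N) ℂ) := fun μ x => hGU (hU μ x)
  have hparK : ∀ z w : SiteY i, parKnitY i U z w ∈ unitaryUnits (Matrix (Fin N) (Fin N) ℂ) :=
    fun z w => parKnitY_mem_unitary_of_reg335P i hG1 hGU U hc hMα hreg hα' hα3 hα2 hK z w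
  have hSb : 0 ≤ ∑ j, ‖b j‖ := Finset.sum_nonneg fun _ _ => norm_nonneg _
  have hθE0 : 0 ≤ 32 * ((d : ℝ) + 1) ^ 2 * α₀' * (M₂ * ∑ j, ‖b j‖) := mul_nonneg (by positivity) (mul_nonneg hM₂ hSb)
  have hcg : 0 ≤ B6.c1 dg δ₀ αg := c1_nonneg dg δ₀ αg
  have hAK0 : 0 ≤ A * B6.c1 dg δ₀ αg * (1 - 32 * ((d : ℝ) + 1) ^ 2 * α₀' * (M₂ * ∑ j, ‖b j‖) * A * B6.c1 dg δ₀ αg)⁻¹ :=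
    mul_nonneg (mul_nonneg hA hcg) (inv_nonneg.2 (sub_nonneg.2 hsmallg.le))
  have hc₁ := c1_nonneg d₁ ((1 - αst) * δ) α'
  have hc₂ := c1_nonneg d₂ ((1 - αst) * ((1 - α') * ((1 - αst) * δ))) α'
  have hc₃ := c1_nonneg d₃ ((1 - αst) * ((1 - α') * ((1 - αst) * ((1 - α') * ((1 - αst) * δ))))) α'
  have hc₄ := c1_nonneg d₄ ((1 - α') * ((1 - αst) * ((1 - α') * ((1 - αst) * ((1 - α') * ((1 - αst) * δ)))))) α
  have hθF0 : 0 ≤ (2 * (8 * ((d : ℝ) + 1) ^ 2 * α₀') * (M₂ * ∑ j, ‖b j‖)) * (M₂ * ∑ j, ‖b j‖) * (A * A * C * B6.c1 d₁ ((1 - αst) * δ) α') +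
      (M₂ * ∑ j, ‖b j‖) * (M₂ * ∑ j, ‖b j‖) *
        ((A + A * B6.c1 dg δ₀ αg * (1 - 32 * ((d : ℝ) + 1) ^ 2 * α₀' * (M₂ * ∑ j, ‖b j‖) * A * B6.c1 dg δ₀ αg)⁻¹) *
          (A * B6.c1 dg δ₀ αg * (1 - 32 * ((d : ℝ) + 1) ^ 2 * α₀' * (M₂ * ∑ j, ‖b j‖) * A * B6.c1 dg δ₀ αg)⁻¹ *
            (32 * ((d : ℝ) + 1) ^ 2 * α₀' * (M₂ * ∑ j, ‖b j‖) * A) * C * B6.c1 d₁ ((1 - αst) * δ) α') * C *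
          B6.c1 d₂ ((1 - αst) * ((1 - α') * ((1 - αst) * δ))) α') +
      (M₂ * ∑ j, ‖b j‖) * ((2 * (8 * ((d : ℝ) + 1) ^ 2 * α₀') * (M₂ * ∑ j, ‖b j‖))) *
        (A * B6.c1 dg δ₀ αg * (1 - 32 * ((d : ℝ) + 1) ^ 2 * α₀' * (M₂ * ∑ j, ‖b j‖) * A * B6.c1 dg δ₀ αg)⁻¹ *
          (A * B6.c1 dg δ₀ αg * (1 - 32 * ((d : ℝ) + 1) ^ 2 * α₀' * (M₂ * ∑ j, ‖b j‖) * A * B6.c1 dg δ₀ αg)⁻¹) * C * B6.c1 d₁ ((1 - αst) * δ) α') := by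
    positivity
  have hKK0 : 0 ≤ K * B6.c1 d₄ ((1 - α') * ((1 - αst) * ((1 - α') * ((1 - αst) * ((1 - α') * ((1 - αst) * δ)))))) α *
      (1 - ((2 * (8 * ((d : ℝ) + 1) ^ 2 * α₀') * (M₂ * ∑ j, ‖b j‖)) * (M₂ * ∑ j, ‖b j‖) * (A * A * C * B6.c1 d₁ ((1 - αst) * δ) α') +
          (M₂ * ∑ j, ‖b j‖) * (M₂ * ∑ j, ‖b j‖) *
            ((A + A * B6.c1 dg δ₀ αg * (1 - 32 * ((d : ℝ) + 1) ^ 2 * α₀' * (M₂ * ∑ j, ‖b j‖) * A * B6.c1 dg δ₀ αg)⁻¹) *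
              (A * B6.c1 dg δ₀ αg * (1 - 32 * ((d : ℝ) + 1) ^ 2 * α₀' * (M₂ * ∑ j, ‖b j‖) * A * B6.c1 dg δ₀ αg)⁻¹ *
                (32 * ((d : ℝ) + 1) ^ 2 * α₀' * (M₂ * ∑ j, ‖b j‖) * A) * C * B6.c1 d₁ ((1 - αst) * δ) α') * C *
              B6.c1 d₂ ((1 - αst) * ((1 - α') * ((1 - αst) * δ))) α') +
          (M₂ * ∑ j, ‖b j‖) * ((2 * (8 * ((d : ℝ) + 1) ^ 2 * α₀') * (M₂ * ∑ j, ‖b j‖))) *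
            (A * B6.c1 dg δ₀ αg * (1 - 32 * ((d : ℝ) + 1) ^ 2 * α₀' * (M₂ * ∑ j, ‖b j‖) * A * B6.c1 dg δ₀ αg)⁻¹ *
              (A * B6.c1 dg δ₀ αg * (1 - 32 * ((d : ℝ) + 1) ^ 2 * α₀' * (M₂ * ∑ j, ‖b j‖) * A * B6.c1 dg δ₀ αg)⁻¹) * C * B6.c1 d₁ ((1 - αst) * δ) α')) * K * C₄ *
        B6.c1 d₃ ((1 - αst) * ((1 - α') * ((1 - αst) * ((1 - α') * ((1 - αst) * δ))))) α' *
        B6.c1 d₄ ((1 - α') * ((1 - αst) * ((1 - α') * ((1 - αst) * ((1 - α') * ((1 - αst) * δ)))))) α)⁻¹ :=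
    mul_nonneg (mul_nonneg hK0 hc₄) (inv_nonneg.2 (sub_nonneg.2 hsmall.le))
  -- the rate chain `ρ ≤ (1−α)δ₃ ≤ δ₃ ≤ δ₂ ≤ δ₁ ≤ δ ≤ δ₀`
  have hδδ₀ : δ ≤ δ₀ := hδ.trans (by linarith only [hαδg'])
  have h1 : (1 - α') * ((1 - αst) * δ) ≤ δ := rate_le hαδ hα'0 hδ'
  have h2 : (1 - α') * ((1 - αst) * ((1 - α') * ((1 - αst) * δ))) ≤ (1 - α') * ((1 - αst) * δ) := rate_le hαδ₂ hα'0 hδ'₂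
  have h3 : (1 - α') * ((1 - αst) * ((1 - α') * ((1 - αst) * ((1 - α') * ((1 - αst) * δ))))) ≤
      (1 - α') * ((1 - αst) * ((1 - α') * ((1 - αst) * δ))) := rate_le hαδ₃ hα'0 hδ'₃
  have hδ₃0 : 0 ≤ (1 - α') * ((1 - αst) * ((1 - α') * ((1 - αst) * ((1 - α') * ((1 - αst) * δ))))) := mul_nonneg (sub_nonneg.2 hα'1) hδ'₃
  have h4 : (1 - α) * ((1 - α') * ((1 - αst) * ((1 - α') * ((1 - αst) * ((1 - α') * ((1 - αst) * δ)))))) ≤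
      (1 - α') * ((1 - αst) * ((1 - α') * ((1 - αst) * ((1 - α') * ((1 - αst) * δ))))) := by linarith only [mul_nonneg hα0 hδ₃0]
  have h5 : 0 ≤ 2 * (α₅ + β₅) * δ₅ := by positivity
  have hρc : ρ ≤ (1 - α) * ((1 - α') * ((1 - αst) * ((1 - α') * ((1 - αst) * ((1 - α') * ((1 - αst) * δ)))))) := by linarith only [hr₅, h5]
  have hcS : (1 - α) * ((1 - α') * ((1 - αst) * ((1 - α') * ((1 - αst) * ((1 - α') * ((1 - αst) * δ)))))) ≤ δ₀ := by
    linarith only [h4, h3, h2, h1, hδδ₀]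
  have hcF : (1 - α) * ((1 - α') * ((1 - αst) * ((1 - α') * ((1 - αst) * ((1 - α') * ((1 - αst) * δ)))))) ≤
      (1 - α') * ((1 - αst) * ((1 - α') * ((1 - αst) * δ))) := by linarith only [h4, h3]
  -- the block-diagonal letter and the two (3.42)₁ majorants at the base rate `δ` (file 9), then 23b's `F` at `δ₂`
  have hE := hasMajorant_conj_smul_sub_print_reg335 i b ιB (Rr := Rr) (Hp := Hp) hG1 hGU hc hMα hreg hα' hα3 hα2 hK hι hcf hM₂ hrepr
  have hGk := hasMajorant_conj_GpY_parKnitY_of_parSymY_reg335 i b ιB (Rr := Rr) (Hp := Hp) hG1 hGU hc hMα hreg hα' hα3 hα2 hK hι hcf hM₂ hrepr dg hA hαδg htri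
    hrefl hdnn h261g h263g hsmallg hGs
  have hGs' := hasMajorant_rate_mono i (Rr := Rr) (Hp := Hp) (fun p : SiteY i × ι => ιB (blkOf i.D.toDomains p.1))
    (fun a => (geo9K i).len a ^ 2) hA (fun a => sq_nonneg _) hδδ₀ hGs
  have hGk' := hasMajorant_rate_mono i (Rr := Rr) (Hp := Hp) (fun p : SiteY i × ι => ιB (blkOf i.D.toDomains p.1))
    (fun a => (geo9K i).len a ^ 2) hAK0 (fun a => sq_nonneg _) hδ hGk
  have hF := hasMajorant_conj_XY_sym_sub_knit_reg335 i b ιB (Rr := Rr) (Hp := Hp) hG1 hGU hc hMα hreg hα' hα3 hα2 hK hM₂ hrepr d₁ d₂ hA hAK0 hθE0 hC hC1 hαδ hα'0 hα'1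
    hδ' hαδ₂ hδ'₂ htri hdnn hST h261 hST₂ h261₂ hE hGs' hGk'
  have hw4 : ∀ a : (geo9K i).Site, 0 ≤ ((geo9K i).len a ^ 4)⁻¹ := fun a => inv_nonneg.2 (pow_nonneg (geo9K_len_pos i a).le 4)
  have hw4' : ∀ a : (geo9K i).Site, 0 ≤ (geo9K i).len a ^ 4 := fun a => pow_nonneg (geo9K_len_pos i a).le 4
  have hF' := hasMajorant_rate_mono i (Rr := Rr) (Hp := Hp) (fun q : BlkY i × ι => ιB q.1) (fun a => (geo9K i).len a ^ 4) hθF0 hw4' hcF hF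
  -- the two `C`-letters at the common constant `max K K_K` and the common rate `(1−α)δ₃`
  have hKM := le_max_left K (K * B6.c1 d₄ ((1 - α') * ((1 - αst) * ((1 - α') * ((1 - αst) * ((1 - α') * ((1 - αst) * δ)))))) α *
      (1 - ((2 * (8 * ((d : ℝ) + 1) ^ 2 * α₀') * (M₂ * ∑ j, ‖b j‖)) * (M₂ * ∑ j, ‖b j‖) * (A * A * C * B6.c1 d₁ ((1 - αst) * δ) α') +
          (M₂ * ∑ j, ‖b j‖) * (M₂ * ∑ j, ‖b j‖) *
            ((A + A * B6.c1 dg δ₀ αg * (1 - 32 * ((d : ℝ) + 1) ^ 2 * α₀' * (M₂ * ∑ j, ‖b j‖) * A * B6.c1 dg δ₀ αg)⁻¹) *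
              (A * B6.c1 dg δ₀ αg * (1 - 32 * ((d : ℝ) + 1) ^ 2 * α₀' * (M₂ * ∑ j, ‖b j‖) * A * B6.c1 dg δ₀ αg)⁻¹ *
                (32 * ((d : ℝ) + 1) ^ 2 * α₀' * (M₂ * ∑ j, ‖b j‖) * A) * C * B6.c1 d₁ ((1 - αst) * δ) α') * C *
              B6.c1 d₂ ((1 - αst) * ((1 - α') * ((1 - αst) * δ))) α') +
          (M₂ * ∑ j, ‖b j‖) * ((2 * (8 * ((d : ℝ) + 1) ^ 2 * α₀') * (M₂ * ∑ j, ‖b j‖))) *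
            (A * B6.c1 dg δ₀ αg * (1 - 32 * ((d : ℝ) + 1) ^ 2 * α₀' * (M₂ * ∑ j, ‖b j‖) * A * B6.c1 dg δ₀ αg)⁻¹ *
              (A * B6.c1 dg δ₀ αg * (1 - 32 * ((d : ℝ) + 1) ^ 2 * α₀' * (M₂ * ∑ j, ‖b j‖) * A * B6.c1 dg δ₀ αg)⁻¹) * C * B6.c1 d₁ ((1 - αst) * δ) α')) * K * C₄ *
        B6.c1 d₃ ((1 - αst) * ((1 - α') * ((1 - αst) * ((1 - α') * ((1 - αst) * δ))))) α' *
        B6.c1 d₄ ((1 - α') * ((1 - αst) * ((1 - α') * ((1 - αst) * ((1 - α') * ((1 - αst) * δ)))))) α)⁻¹)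
  have hM0 := hK0.trans hKM
  have hCS' := hasMajorant_mono (g := toB6 (geo9K i) Rr Hp) _
    (hasMajorant_rate_mono i (Rr := Rr) (Hp := Hp) (fun q : BlkY i × ι => ιB q.1) (fun a => ((geo9K i).len a ^ 4)⁻¹) hK0 hw4 hcS hT₀)
    fun a a' => mul_le_mul_of_nonneg_right (mul_le_mul_of_nonneg_right hKM (hw4 a)) (Real.exp_nonneg _)
  have hCK' := hasMajorant_mono (g := toB6 (geo9K i) Rr Hp) _ hCK
    fun a a' => mul_le_mul_of_nonneg_right (mul_le_mul_of_nonneg_right (le_max_right K _) (hw4 a)) (Real.exp_nonneg _)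
  -- §4 on the triple product, and the two `C`-letters at the rate `ρ`
  have hdC := hasMajorant_conj_XinvY_sub_pars_of_majorants i b ιB (Rr := Rr) (Hp := Hp) le_rfl hUu hparK d₅ δ₅ _ α₅ β₅ ρ Λ₄ _ _ hM0 hθF0 hΛ₄ hρ hα₅ hβ₅
    hδ₅ hr₅ htri h261₅ hT4₅ hCS' hCK' hF'
  exact ⟨hasMajorant_rate_mono i (Rr := Rr) (Hp := Hp) (fun q : BlkY i × ι => ιB q.1) (fun a => ((geo9K i).len a ^ 4)⁻¹) hM0 hw4 hρc hCS',
    hasMajorant_rate_mono i (Rr := Rr) (Hp := Hp) (fun q : BlkY i × ι => ιB q.1) (fun a => ((geo9K i).len a ^ 4)⁻¹) hM0 hw4 hρc hCK', hdC⟩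

end Literature.MathematicalPhysics.QuantumFieldTheory.Balaban1983to89.B9B8KnitBondCLettersAtParsReg335

end
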